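import Literature.AnabelianGeometry.EtaleTheta.ThetaSystems

/-!
# [EtTh] §5, Theorem 5.7 (C)-chain, ÉTALE half: the torsion clause «`κ_N^{2l}` is a coboundary» from constant-multiple
# rigidity on the tower (Cor. 2.19 (iii) / Cor. 2.8 (i)), translation-freeness and the separation of the orbit ACROSS LEVELS
# (pp. 247–248, 268, 291 / PDF pp. 21–22, 42, 65)

Mochizuki, *The étale theta function and its Frobenioid-theoretic manifestations*, Publ. RIMS **45** (2009)
[cite: MochizukiEtTh2009, Cor 2.19 (iii) p.291 (PDF p.65); Cor 2.8 (i) p.268 (PDF p.42); Prop 1.4 (ii) p.248 (PDF p.22);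
Prop 1.3 p.245–247 (PDF pp.19–21); Thm 5.7 proof p.330 (PDF p.104)].
Seat abc-iut-w6-d049 (gen 5; node `EtTh:Thm5.7`, abc-iut-L2-lead (gen 5) R633 «R535 (b) — the (tor) content»), second file of the
row after `Sec5Thm57TorsionOfKummerCocycle.lean` (p473372).  PROOF-ONLY (0 definitions) over abc-iut-L2-t2's `ThetaSystems.lean` /
`ThetaRigidity.lean` and `CyclotomicEnvelope.lean`; nothing landed is edited or restated.

THE POINT.  p473372 reduced the (C)-binder of Thm. 5.7 to, per level `N` of a cofinal set, the ÉTALE clause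
  (E-tors_N)  `∃ d : μ_N, ∀ k ∈ Π^tp_Ÿ, κ_N(k)^{2l} = d·(χ(aug k) d)⁻¹`
for the cocycle `κ_N` of `hC5` («`γ_Δ(η k) = η(γ k)·κ(γ k)`», p453757) at `γ_Δ := φΛ`.  This file derives it ON A TOWER
`𝒯 : ThetaEnvTower E` (abc-iut-L2-t2) from named shapes, all levels at once:
* `hstd` — VERBATIM the conclusion of abc-iut-L2-t2's FACT `MuTwoSetting.Cor219_iii_std` (FACT-LIST F-0652; Cor. 2.19 (iii) WITH the
  standard-type clause = Cor. 2.8 (i)): a compatible family `c` of `G_K`-cocycles with `γ^*(TC_M) = TC_M · (c_M ∘ aug)` and `c_M^l ∼ ∂`;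
* `hC5` at every level (the HC-tautology of abc-iut-L2-d3's J-L2d3-1 (1)) and `hinf` — «`κ_M` is `G_K`-inflated» at every level
  (VERBATIM the conclusion shape of GAP G-L2d3-8 = (T3), or (II′) of R664);
* `hηc` — the pinned cocycles `η_M` form a COMPATIBLE family (Prop. 1.3 / Lemma 1.2: «compatible system as `N` varies»);
* `hsep` — SEPARATION ACROSS LEVELS: two compatible families of members of the collections that differ by an inflated function at
  EVERY level differ, at every level, by a class killed by `2` (print: the orbit `η̈^{Θ,l·ℤ×μ₂}` is `{η·Kum((−1)^a q^{−a²/2} Ü^{−2a})·Kum(±1)}`,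
  Prop. 1.4 (ii); `Kum(Ü^{−2a})` is inflated mod `M` only if `M ∣ 2a`, so inflated at ALL levels forces `a = 0`, leaving `Kum(±1)`).
  The single-level version is FALSE in general (Prop. 2.14 (iii): `Im_N ⊇ N·l·ℤ ⋊ {±1}`), which is why the statement is on the tower;
* glue: `γ_μ` is `χ`-equivariant (`hγμχ`; PROVED for `RigidData` from `thetaMod_conj`: `RigidData.gammaMu_chi_of_thetaMod`), commutes
  with the reductions (`red_gammaMu_of_thetaMod`, PROVED from the Cor. 2.19 (iii) hypothesis shape), and `γ` respects `aug`-fibres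
  (`aug_apply_eq_of_ker_map_eq`, PROVED from the Cor. 2.18 (i) clause `γ(Δ_X) = Δ_X`).
RESULT `ThetaEnvTower.etaleTorsion_of_cor219iiiStd`: (E-tors_M) at EVERY level `M ∈ E`, with witness `d := (γ_μ(d₁^l·d₂²))⁻¹`.
HONEST FRAMING: kernel-checked implications between typed statements over an ABSTRACT tower; none of `hstd`/`hinf`/`hsep`/`hηc`/`hC5` is
proved here, nor asserted to hold at any model; nothing of [EtTh] is asserted unconditionally; typed ≠ discharged; no side taken on anything
downstream ([IUTchIII] Cor. 3.12 in particular).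
-/

namespace Literature.AnabelianGeometry.EtaleTheta

universe u

/-! ### Coboundary bookkeeping (p.47: «modifying a cocycle by a coboundary») -/

namespace CycEnvelope

variable {P G μ : Type*} [Group P] [Group G] [CommGroup μ] (aug : P →* G) (χ : G →* MulAut μ)

/-- Coboundaries multiply. [cite: MochizukiEtTh2009, Def 2.13 p.47] -/
theorem coboundary_mul_apply (c c' : μ) (g : P) :
    coboundary aug χ (c * c') g = coboundary aug χ c g * coboundary aug χ c' g := by
  simp only [coboundary, map_mul, mul_inv]
  rw [mul_mul_mul_comm]

/-- Powers of coboundaries. [cite: MochizukiEtTh2009, Def 2.13 p.47] -/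
theorem coboundary_pow_apply (c : μ) (n : ℕ) (g : P) :
    coboundary aug χ c g ^ n = coboundary aug χ (c ^ n) g := by
  simp only [coboundary, map_pow, mul_pow, inv_pow]

/-- Inverses of coboundaries. [cite: MochizukiEtTh2009, Def 2.13 p.47] -/
theorem coboundary_inv_apply (c : μ) (g : P) :
    (coboundary aug χ c g)⁻¹ = coboundary aug χ c⁻¹ g := by
  simp only [coboundary, map_inv, mul_inv, inv_inv]

end CycEnvelope

/-! ### `RigidData` glue: the induced coefficient automorphism is `χ`-equivariant -/

namespace RigidData

variable {N : ℕ+} {l : ℕ} (R : RigidData.{u} N l)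

/-- **`γ_μ` is `χ`-equivariant**: if `γ ∈ Aut(Π^tp_X)` stabilises `(l·Δ_Θ)` and induces `γ_μ` on `(l·Δ_Θ) ⊗ ℤ/N ≅ μ_N` through
`thetaMod` (Cor. 2.18 (i) / Cor. 2.19 (iii) hypothesis shape), then `γ_μ(χ(aug x)·t) = χ(aug(γ x))·γ_μ(t)` — from the
`Π^tp_X`-equivariance of `thetaMod` (`thetaMod_conj`) and its surjectivity.  [cite: MochizukiEtTh2009, Cor 2.19 (iii) p.291 (PDF p.65)] -/
theorem gammaMu_chi_of_thetaMod (γ : R.PiX ≃* R.PiX) (hΔ : ∀ g : R.PiX, g ∈ R.lDeltaTheta → γ g ∈ R.lDeltaTheta)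
    (γμ : R.mu ≃* R.mu) (hμ : ∀ g : R.lDeltaTheta, R.thetaMod ⟨γ g, hΔ g g.2⟩ = γμ (R.thetaMod g))
    (x : R.PiX) (t : R.mu) : γμ (R.chi (R.aug x) t) = R.chi (R.aug (γ x)) (γμ t) := by
  obtain ⟨g, rfl⟩ := R.thetaMod_surjective t
  have hxg : x * (g : R.PiX) * x⁻¹ ∈ R.lDeltaTheta := R.lDeltaTheta_normal.conj_mem _ g.2 x
  rw [← R.thetaMod_conj x g, ← hμ g, ← R.thetaMod_conj (γ x) ⟨γ g, hΔ g g.2⟩, ← hμ ⟨_, hxg⟩]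
  congr 1
  exact Subtype.ext (by simp only [map_mul, map_inv])

end RigidData

namespace ThetaEnvTower

variable {E : Set ℕ+} (𝒯 : ThetaEnvTower.{u} E)

/-- `γ(Π^tp_Ÿ) = Π^tp_Ÿ` gives `γ g ∈ Π^tp_Ÿ`. [cite: MochizukiEtTh2009, Cor 2.18 (i) p.286 (PDF p.60)] -/
theorem apply_mem_PiYdd_of_map_eq (γ : 𝒯.PiX ≃ₜ* 𝒯.PiX) (hγ : 𝒯.PiYdd.map γ.toMulEquiv.toMonoidHom = 𝒯.PiYdd)
    (x : 𝒯.PiX) (hx : x ∈ 𝒯.PiYdd) : γ x ∈ 𝒯.PiYdd := by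
  have : γ x ∈ 𝒯.PiYdd.map γ.toMulEquiv.toMonoidHom := ⟨x, hx, rfl⟩
  rwa [hγ] at this

/-- … and `γ⁻¹ g ∈ Π^tp_Ÿ`. [cite: MochizukiEtTh2009, Cor 2.18 (i) p.286 (PDF p.60)] -/
theorem symm_apply_mem_PiYdd_of_map_eq (γ : 𝒯.PiX ≃ₜ* 𝒯.PiX) (hγ : 𝒯.PiYdd.map γ.toMulEquiv.toMonoidHom = 𝒯.PiYdd)
    (x : 𝒯.PiX) (hx : x ∈ 𝒯.PiYdd) : γ.symm x ∈ 𝒯.PiYdd := by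
  rw [← hγ] at hx
  obtain ⟨y, hy, hyx⟩ := hx
  have : γ.symm x = y := by
    rw [← hyx]
    exact γ.symm_apply_apply y
  rw [this]
  exact hy

/-- `γ` respects the fibres of `aug` as soon as it stabilises `Δ_X = Ker(aug)` (the Cor. 2.18 (i) clause `γ(Δ_X) = Δ_X`).
[cite: MochizukiEtTh2009, Cor 2.18 (i) p.286 (PDF p.60)] -/
theorem aug_apply_eq_of_ker_map_eq (γ : 𝒯.PiX ≃ₜ* 𝒯.PiX) (hker : 𝒯.aug.ker.map γ.toMulEquiv.toMonoidHom = 𝒯.aug.ker)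
    (x y : 𝒯.PiX) (h : 𝒯.aug x = 𝒯.aug y) : 𝒯.aug (γ x) = 𝒯.aug (γ y) := by
  have hxy : x * y⁻¹ ∈ 𝒯.aug.ker := by rw [MonoidHom.mem_ker, map_mul, map_inv, h, mul_inv_cancel]
  have : γ (x * y⁻¹) ∈ 𝒯.aug.ker := by
    have hm : γ (x * y⁻¹) ∈ 𝒯.aug.ker.map γ.toMulEquiv.toMonoidHom := ⟨_, hxy, rfl⟩
    rwa [hker] at hm
  rw [MonoidHom.mem_ker, map_mul, map_inv, map_mul, map_inv, mul_inv_eq_one] at this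
  exact this

/-- **`γ_μ` commutes with the reductions** `μ_{M'} ↠ μ_M`, from the Cor. 2.19 (iii) hypothesis shape («`γ_μ` is induced through
`thetaMod` at every level») and the compatibility `red ∘ thetaMod_{M'} = thetaMod_M`.  [cite: MochizukiEtTh2009, Cor 2.19 (iii) p.291 (PDF p.65)] -/
theorem red_gammaMu_of_thetaMod (γ : 𝒯.PiX ≃ₜ* 𝒯.PiX) (hΔ : ∀ g : 𝒯.PiX, g ∈ 𝒯.lDeltaTheta → γ g ∈ 𝒯.lDeltaTheta)
    (γμ : ∀ M : E, 𝒯.mu M ≃* 𝒯.mu M)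
    (hμ : ∀ (M : E) (g : 𝒯.lDeltaTheta) (hg : γ g ∈ 𝒯.lDeltaTheta), 𝒯.thetaMod M ⟨γ g, hg⟩ = γμ M (𝒯.thetaMod M g))
    (M M' : E) (h : (M : ℕ+) ∣ M') (t : 𝒯.mu M') : 𝒯.red M M' h (γμ M' t) = γμ M (𝒯.red M M' h t) := by
  obtain ⟨g, rfl⟩ := 𝒯.thetaMod_surjective M' t
  rw [← hμ M' g (hΔ g g.2), 𝒯.red_thetaMod, 𝒯.red_thetaMod, hμ M g (hΔ g g.2)]

/-- `pullbackCocycle` unfolded. [cite: MochizukiEtTh2009, Cor 2.19 (iii) p.291 (PDF p.65)] -/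
theorem pullbackCocycle_apply (M : E) (γ : 𝒯.PiX ≃ₜ* 𝒯.PiX) (hγ : 𝒯.PiYdd.map γ.toMulEquiv.toMonoidHom = 𝒯.PiYdd)
    (γμ : 𝒯.mu M ≃* 𝒯.mu M) (η : 𝒯.PiYdd → 𝒯.mu M) (g : 𝒯.PiYdd) :
    𝒯.pullbackCocycle M γ hγ γμ η g = γμ.symm (η ⟨γ g, 𝒯.apply_mem_PiYdd_of_map_eq γ hγ g g.2⟩) := rfl

/-! ### One level: transporting a torsion clause through `(γ, γ_μ)` -/

/-- **Transport of the torsion clause through `(γ, γ_μ)`** (one level, pure bookkeeping).  If `hC5` holds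
(`γ_μ(η k) = η(γ k)·κ(γ k)`), the pull-back `γ^*η := γ_μ⁻¹ ∘ η ∘ γ` equals `η·f`, and `f^n` is the coboundary of `d`, then `κ^n` is the
coboundary of `(γ_μ d)⁻¹` — because `κ(γ k) = γ_μ(f k)⁻¹` and `γ_μ` is `χ`-equivariant.  [cite: MochizukiEtTh2009, Cor 2.19 (iii) p.291 (PDF p.65); Thm 5.7 proof p.330 (PDF p.104)] -/
theorem pow_eq_coboundary_of_pullback (M : E) (γ : 𝒯.PiX ≃ₜ* 𝒯.PiX) (hγ : 𝒯.PiYdd.map γ.toMulEquiv.toMonoidHom = 𝒯.PiYdd)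
    (hγ' : ∀ x : 𝒯.PiX, x ∈ 𝒯.PiYdd → γ x ∈ 𝒯.PiYdd) (γμ : 𝒯.mu M ≃* 𝒯.mu M)
    (hγμχ : ∀ (x : 𝒯.PiX) (t : 𝒯.mu M), γμ (𝒯.chi M (𝒯.aug x) t) = 𝒯.chi M (𝒯.aug (γ x)) (γμ t))
    (η κ : 𝒯.PiYdd → 𝒯.mu M) (hC5 : ∀ k : 𝒯.PiYdd, γμ (η k) = η ⟨γ k, hγ' k k.2⟩ * κ ⟨γ k, hγ' k k.2⟩)
    (f : 𝒯.PiYdd → 𝒯.mu M) (hf : ∀ k, 𝒯.pullbackCocycle M γ hγ γμ η k = η k * f k) {n : ℕ} {d : 𝒯.mu M}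
    (hfn : ∀ k, f k ^ n = CycEnvelope.coboundary (𝒯.aug.comp 𝒯.PiYdd.subtype) (𝒯.chi M) d k) (k : 𝒯.PiYdd) :
    κ k ^ n = CycEnvelope.coboundary (𝒯.aug.comp 𝒯.PiYdd.subtype) (𝒯.chi M) (γμ d)⁻¹ k := by
  -- write `k = γ k₀`
  set k₀ : 𝒯.PiYdd := ⟨γ.symm k, 𝒯.symm_apply_mem_PiYdd_of_map_eq γ hγ k k.2⟩ with hk₀
  have hγk₀ : (⟨γ k₀, hγ' k₀ k₀.2⟩ : 𝒯.PiYdd) = k := Subtype.ext (γ.apply_symm_apply k)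
  -- `κ k = γμ (f k₀)⁻¹`
  have h5 := hC5 k₀
  rw [hγk₀] at h5
  have hpb : γμ.symm (η k) = η k₀ * f k₀ := by
    rw [← hf k₀, pullbackCocycle_apply]
    exact congrArg (fun x : 𝒯.PiYdd => γμ.symm (η x)) hγk₀.symm
  have hηk : η k = γμ (η k₀) * γμ (f k₀) := by
    rw [← map_mul, ← hpb, MulEquiv.apply_symm_apply]
  have hκ : κ k = (γμ (f k₀))⁻¹ := by
    rw [hηk, mul_assoc] at h5
    exact eq_inv_of_mul_eq_one_right (mul_eq_left.mp h5.symm)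
  -- transport the coboundary
  have haug : 𝒯.aug (k : 𝒯.PiX) = 𝒯.aug (γ (k₀ : 𝒯.PiX)) := by
    rw [hk₀]; exact congrArg 𝒯.aug (γ.apply_symm_apply k).symm
  rw [hκ, inv_pow, ← map_pow, hfn k₀]
  simp only [CycEnvelope.coboundary, MonoidHom.coe_comp, Function.comp_apply, Subgroup.coe_subtype, map_mul, map_inv,
    hγμχ, mul_inv, inv_inv, haug]

/-- **Assembling the torsion of the pull-back factor**: if `γ^*η = η₁·e` with `(η₁·η⁻¹)²` and `e^l` coboundaries, then the factor
`f := η₁·e·η⁻¹` (so that `γ^*η = η·f`) has `f^{2l}` a coboundary.  [cite: MochizukiEtTh2009, Cor 2.8 (i) p.268 (PDF p.42); Prop 1.4 (ii) p.248 (PDF p.22)] -/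
theorem factor_pow_two_mul_eq_coboundary (M : E) (η η₁ e : 𝒯.PiYdd → 𝒯.mu M) {l : ℕ} {d₁ d₂ : 𝒯.mu M}
    (h₁ : ∀ k, (η₁ k * (η k)⁻¹) ^ 2 = CycEnvelope.coboundary (𝒯.aug.comp 𝒯.PiYdd.subtype) (𝒯.chi M) d₁ k)
    (h₂ : ∀ k, e k ^ l = CycEnvelope.coboundary (𝒯.aug.comp 𝒯.PiYdd.subtype) (𝒯.chi M) d₂ k) (k : 𝒯.PiYdd) :
    (η₁ k * e k * (η k)⁻¹) ^ (2 * l) =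
      CycEnvelope.coboundary (𝒯.aug.comp 𝒯.PiYdd.subtype) (𝒯.chi M) (d₁ ^ l * d₂ ^ 2) k := by
  have hre : η₁ k * e k * (η k)⁻¹ = (η₁ k * (η k)⁻¹) * e k := mul_right_comm _ _ _
  rw [hre, mul_pow, pow_mul, h₁, mul_comm 2 l, pow_mul, h₂, CycEnvelope.coboundary_pow_apply,
    CycEnvelope.coboundary_pow_apply, CycEnvelope.coboundary_mul_apply]

/-! ### The tower theorem -/

/-- **(E-tors) at every level from constant-multiple rigidity on the tower, translation-freeness and separation across levels.**
See the module docstring for the binders: `hstd` (VERBATIM the conclusion of `MuTwoSetting.Cor219_iii_std`, F-0652), `hγμχ`, `hγμred`,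
`haug` (glue, derivable), a COMPATIBLE family `η` of members with `hC5` and the inflatedness `hinf` of `κ` at every level, and the
cross-level separation `hsep`.  Conclusion: at every level `M`, `κ_M^{2l}` is a coboundary — the input `htors` of
`ThetaFrobenioid.kummerTorsion_of_etaleTorsion` (p473372) with `n := 2l`.
[cite: MochizukiEtTh2009, Cor 2.19 (iii) p.291 (PDF p.65); Cor 2.8 (i) p.268 (PDF p.42); Prop 1.4 (ii) p.248 (PDF p.22); Thm 5.7 proof p.330 (PDF p.104)] -/
theorem etaleTorsion_of_cor219iiiStd {l : ℕ} (γ : 𝒯.PiX ≃ₜ* 𝒯.PiX)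
    (hγ : 𝒯.PiYdd.map γ.toMulEquiv.toMonoidHom = 𝒯.PiYdd) (hγ' : ∀ x : 𝒯.PiX, x ∈ 𝒯.PiYdd → γ x ∈ 𝒯.PiYdd)
    (γμ : ∀ M : E, 𝒯.mu M ≃* 𝒯.mu M)
    (hstd : ∃ c : ∀ M : E, 𝒯.G → 𝒯.mu M,
      (∀ M, CycEnvelope.IsEnvCocycle (MonoidHom.id 𝒯.G) (𝒯.chi M) (c M)) ∧
      (∀ M, IsLocallyConstant (c M ∘ 𝒯.aug)) ∧
      (∀ (M M' : E) (h : (M : ℕ+) ∣ M'), 𝒯.red M M' h ∘ c M' = c M) ∧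
      (∀ M, 𝒯.pullbackCocycle M γ hγ (γμ M) '' 𝒯.thetaCocycles M =
        (fun η => η * (c M ∘ 𝒯.aug ∘ 𝒯.PiYdd.subtype)) '' 𝒯.thetaCocycles M) ∧
      ∀ M : E, ∃ d : 𝒯.mu M, ∀ g : 𝒯.G, c M g ^ l = CycEnvelope.coboundary (MonoidHom.id 𝒯.G) (𝒯.chi M) d g)
    (hγμχ : ∀ (M : E) (x : 𝒯.PiX) (t : 𝒯.mu M), γμ M (𝒯.chi M (𝒯.aug x) t) = 𝒯.chi M (𝒯.aug (γ x)) (γμ M t))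
    (hγμred : ∀ (M M' : E) (h : (M : ℕ+) ∣ M') (t : 𝒯.mu M'), 𝒯.red M M' h (γμ M' t) = γμ M (𝒯.red M M' h t))
    (haug : ∀ x y : 𝒯.PiX, 𝒯.aug x = 𝒯.aug y → 𝒯.aug (γ x) = 𝒯.aug (γ y))
    (η : ∀ M : E, 𝒯.PiYdd → 𝒯.mu M) (hη : ∀ M, η M ∈ 𝒯.thetaCocycles M)
    (hηc : ∀ (M M' : E) (h : (M : ℕ+) ∣ M'), 𝒯.red M M' h ∘ η M' = η M)
    (κ : ∀ M : E, 𝒯.PiYdd → 𝒯.mu M)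
    (hC5 : ∀ (M : E) (k : 𝒯.PiYdd), γμ M (η M k) = η M ⟨γ k, hγ' k k.2⟩ * κ M ⟨γ k, hγ' k k.2⟩)
    (hinf : ∀ (M : E) (k k' : 𝒯.PiYdd), 𝒯.aug k = 𝒯.aug k' → κ M k = κ M k')
    (hsep : ∀ η' : ∀ M : E, 𝒯.PiYdd → 𝒯.mu M, (∀ M, η' M ∈ 𝒯.thetaCocycles M) →
      (∀ (M M' : E) (h : (M : ℕ+) ∣ M'), 𝒯.red M M' h ∘ η' M' = η' M) →
      (∀ (M : E) (k k' : 𝒯.PiYdd), 𝒯.aug k = 𝒯.aug k' → η' M k * (η M k)⁻¹ = η' M k' * (η M k')⁻¹) →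
      ∀ M : E, ∃ d : 𝒯.mu M, ∀ k : 𝒯.PiYdd,
        (η' M k * (η M k)⁻¹) ^ 2 = CycEnvelope.coboundary (𝒯.aug.comp 𝒯.PiYdd.subtype) (𝒯.chi M) d k)
    (M : E) :
    ∃ d : 𝒯.mu M, ∀ k : 𝒯.PiYdd,
      κ M k ^ (2 * l) = CycEnvelope.coboundary (𝒯.aug.comp 𝒯.PiYdd.subtype) (𝒯.chi M) d k := by
  classical
  obtain ⟨c, -, -, hcred, hset, htor⟩ := hstd
  -- the member `η₁_M` with `γ^*η_M = η₁_M · (c_M ∘ aug)` at every level (chosen), and its formula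
  have hex : ∀ M' : E, ∃ η₁ ∈ 𝒯.thetaCocycles M',
      η₁ * (c M' ∘ 𝒯.aug ∘ 𝒯.PiYdd.subtype) = 𝒯.pullbackCocycle M' γ hγ (γμ M') (η M') := fun M' => by
    have hmem : 𝒯.pullbackCocycle M' γ hγ (γμ M') (η M') ∈
        (fun η => η * (c M' ∘ 𝒯.aug ∘ 𝒯.PiYdd.subtype)) '' 𝒯.thetaCocycles M' := by
      rw [← hset M']
      exact ⟨η M', hη M', rfl⟩
    obtain ⟨η₁, hη₁, he⟩ := hmem
    exact ⟨η₁, hη₁, he⟩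
  choose η₁ hη₁ hη₁e using hex
  -- pointwise formula: `η₁_M k = η_M k · (γμ_M⁻¹(κ_M(γ k)))⁻¹ · (c_M (aug k))⁻¹`
  have hform : ∀ (M' : E) (k : 𝒯.PiYdd),
      η₁ M' k = η M' k * (((γμ M').symm (κ M' ⟨γ k, hγ' k k.2⟩))⁻¹ * (c M' (𝒯.aug k))⁻¹) := by
    intro M' k
    have hk := congrFun (hη₁e M') k
    simp only [Pi.mul_apply, Function.comp_apply, Subgroup.coe_subtype] at hk
    rw [pullbackCocycle_apply] at hk
    have hpb : (γμ M').symm (η M' ⟨γ k, 𝒯.apply_mem_PiYdd_of_map_eq γ hγ k k.2⟩) =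
        η M' k * ((γμ M').symm (κ M' ⟨γ k, hγ' k k.2⟩))⁻¹ := by
      apply (γμ M').injective
      rw [MulEquiv.apply_symm_apply, map_mul, map_inv, MulEquiv.apply_symm_apply, hC5 M' k, mul_inv_cancel_right]
    rw [hpb] at hk
    rw [← mul_assoc, ← hk, mul_inv_cancel_right]
  -- the chosen family is COMPATIBLE
  have hη₁c : ∀ (M M' : E) (h : (M : ℕ+) ∣ M'), 𝒯.red M M' h ∘ η₁ M' = η₁ M := by
    intro M M' h
    funext k
    have hk' := congrFun (hη₁e M') k
    have hk := congrFun (hη₁e M) k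
    simp only [Pi.mul_apply, Function.comp_apply, Subgroup.coe_subtype] at hk hk'
    rw [pullbackCocycle_apply] at hk hk'
    -- reduce the level-`M'` identity
    have hred := congrArg (𝒯.red M M' h) hk'
    rw [map_mul, show 𝒯.red M M' h (c M' (𝒯.aug k)) = c M (𝒯.aug k) from congrFun (hcred M M' h) _,
      show 𝒯.red M M' h ((γμ M').symm (η M' ⟨γ k, 𝒯.apply_mem_PiYdd_of_map_eq γ hγ k k.2⟩)) =
        (γμ M).symm (η M ⟨γ k, 𝒯.apply_mem_PiYdd_of_map_eq γ hγ k k.2⟩) from by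
          apply (γμ M).injective
          rw [MulEquiv.apply_symm_apply, ← hγμred, MulEquiv.apply_symm_apply]
          exact congrFun (hηc M M' h) _, ← hk] at hred
    exact mul_right_cancel hred
  -- `η₁ / η` is inflated at every level (`κ` inflated, `γ` respects `aug`-fibres, `c` inflated)
  have hq : ∀ (M' : E) (k k' : 𝒯.PiYdd), 𝒯.aug k = 𝒯.aug k' →
      η₁ M' k * (η M' k)⁻¹ = η₁ M' k' * (η M' k')⁻¹ := by
    intro M' k k' hkk
    rw [hform M' k, hform M' k', mul_inv_cancel_comm, mul_inv_cancel_comm,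
      hinf M' ⟨γ k, hγ' k k.2⟩ ⟨γ k', hγ' k' k'.2⟩ (haug k k' hkk), hkk]
  -- separation across levels: `(η₁/η)²` is a coboundary at level `M`
  obtain ⟨d₁, hd₁⟩ := hsep η₁ hη₁ hη₁c hq M
  obtain ⟨d₂, hd₂⟩ := htor M
  -- the pull-back factor `f := η₁ · (c ∘ aug) · η⁻¹` and its torsion
  refine ⟨(γμ M (d₁ ^ l * d₂ ^ 2))⁻¹, fun k => ?_⟩
  refine 𝒯.pow_eq_coboundary_of_pullback M γ hγ hγ' (γμ M) (hγμχ M) (η M) (κ M) (hC5 M)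
    (fun k => η₁ M k * c M (𝒯.aug k) * (η M k)⁻¹) (fun k => ?_) (fun k => ?_) k
  · -- `γ^*η = η · f`
    have hk := congrFun (hη₁e M) k
    simp only [Pi.mul_apply, Function.comp_apply, Subgroup.coe_subtype] at hk
    rw [← hk, mul_comm (η M k), mul_assoc, inv_mul_cancel, mul_one]
  · exact 𝒯.factor_pow_two_mul_eq_coboundary M (η M) (η₁ M) (fun k => c M (𝒯.aug k)) hd₁ (fun k => hd₂ (𝒯.aug k)) k

end ThetaEnvTower

end Literature.AnabelianGeometry.EtaleTheta
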